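import Literature.Probability.RandomGraphs.PlantedClique
import Literature.Computability.Cryptography.OneWayFunctions
import Mathlib.Analysis.SpecialFunctions.Pow.Real
import HarnessLib

/-!
# Planted clique: recovery above `√n` (Alon–Krivelevich–Sudakov) and uniqueness of the planted clique

Named facts (D-0014) requested by route PneNP/PlantedClique (`wi-03903`), over the vocabulary of
`PlantedClique.lean` (`plantedCliqueJoint`, `recoverProb`, `PlantedCliqueRecoveryHard`,
`PlantedCliqueUniqueWhp`).

Source (text checked, `tmp/aks.txt`): N. Alon, M. Krivelevich, B. Sudakov, *Finding a large hidden
clique in a random graph*, Random Structures Algorithms 13 (1998) 457–466 (SODA 1998). The paper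
has no numbered main theorem; the result is stated in §1 (last paragraph): "for every `ε > 0` there
is a polynomial time algorithm that finds, almost surely, the unique largest clique of size `k` in
`G(n, 1/2, k)`, provided `k ≥ ε n^{1/2}`" (Algorithm A, §2.1, for `k ≥ 10 √n`; Algorithm B, §2.3,
for `k = c √n`, any fixed `c > 0`; the degree algorithm of Kučera for `k > c √(n log n)`, §2), and
again in §3.

* `aks_recovery` — (b) of the request: for every `c > 0` and clique-size sequence `k` with
  `c √n ≤ k n ≤ n` eventually, some probabilistic polynomial-time algorithm recovers the planted
  set with probability `→ 1`; PROVED consequence `aks_recovery.not_recoveryHard`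
  (`¬ PlantedCliqueRecoveryHard k` in that regime — the kill boundary of the route's item #5).
* `aks_unique` — the uniqueness clause AKS print in the same regime: for `k ≥ ε √n` the planted set
  is almost surely the unique largest clique (`PlantedCliqueUniqueWhp k`).

NOT recorded here: uniqueness down to `k ≥ (2 + η) log₂ n` (Kučera 1995 / Jerrum 1992 / clique
number `(2 + o(1)) log₂ n` of `G(n,1/2)`, Matula, Bollobás–Erdős): the printed statements could not
be checked in this session (publisher pages inaccessible); AKS §1 quote the clique-number fact from
Alon–Spencer but not the planted-uniqueness lemma in that regime. Left for a follow-up item.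

"Almost surely" in AKS means probability `→ 1` as `n → ∞` (§1), which is how both facts are
phrased (`Filter.Tendsto … atTop (𝓝 1)`); "polynomial time algorithm" is rendered by G01's
`RandAlg` with `IsPPT` (a deterministic algorithm is the special case with no coins). `IsPPT` is
imported here explicitly from `OneWayFunctions.lean` (item `defn-BernoulliVecStandalone`:
`PlantedClique.lean` spells it out as `RandAlg.IsPolyTime id _` and no longer imports that file, so
that the `G(n, p)` files built on `PlantedClique.lean` do not carry the one-way-function conjectures
in their import cone).

## References

* N. Alon, M. Krivelevich, B. Sudakov, *Finding a large hidden clique in a random graph*, Random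
  Structures Algorithms 13 (1998) 457–466 [AlonKrivelevichSudakov1998].
* L. Kučera, Discrete Appl. Math. 57 (1995) [Kucera1995]; M. Jerrum, Random Structures Algorithms
  3 (1992) [Jerrum1992].
-/

noncomputable section

namespace Literature.Probability.RandomGraphs.PlantedClique

open Literature.Computability.Complexity Literature.Computability.Cryptography Filter Topology

/-- The AKS regime: eventually `c √n ≤ k n ≤ n`. [AKS 1998, §1] [folklore] -/
def InSqrtRegime (c : ℝ) (k : ℕ → ℕ) : Prop :=
  ∀ᶠ n : ℕ in atTop, c * Real.sqrt n ≤ k n ∧ k n ≤ n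

/-- **Alon–Krivelevich–Sudakov (1998): recovery for `k ≥ c √n`.** For every fixed `c > 0` and every
clique-size sequence `k` with `c √n ≤ k(n) ≤ n` for all large `n`, there is a probabilistic
polynomial-time algorithm which, on `G ∼ G(n, 1/2, k(n))`, outputs the planted set with probability
tending to `1`. [cite: AlonKrivelevichSudakov1998, §1 (main result) and §2.3 Algorithm B] -/
def aks_recovery : Prop :=
  ∀ c : ℝ, 0 < c → ∀ k : ℕ → ℕ, InSqrtRegime c k →
    ∃ A : RandAlg (List Bool) (List Bool), IsPPT A id ∧ Tendsto (recoverProb A k) atTop (𝓝 1)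

/-- **AKS (1998), uniqueness clause**: in the same regime the planted set is almost surely the
unique largest clique of `G(n, 1/2, k)`. [cite: AlonKrivelevichSudakov1998, §1 (main result) and §3] -/
def aks_unique : Prop :=
  ∀ c : ℝ, 0 < c → ∀ k : ℕ → ℕ, InSqrtRegime c k → PlantedCliqueUniqueWhp k

/-- Consequence for the route: recovery is NOT hard for `k ≥ c √n` (a sequence tending to `1` does
not tend to `0`). [folklore] -/
theorem aks_recovery.not_recoveryHard (h : aks_recovery) {c : ℝ} (hc : 0 < c) {k : ℕ → ℕ}
    (hk : InSqrtRegime c k) : ¬ PlantedCliqueRecoveryHard k := by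
  obtain ⟨A, hA, h1⟩ := h c hc k hk
  intro hhard
  have h0 := hhard A hA
  have := tendsto_nhds_unique h1 h0
  norm_num at this

/-- The regime is upward closed in `k` (below `n`). [folklore] -/
theorem InSqrtRegime.mono {c : ℝ} {k k' : ℕ → ℕ} (h : InSqrtRegime c k)
    (hkk' : ∀ᶠ n in atTop, k n ≤ k' n ∧ k' n ≤ n) : InSqrtRegime c k' :=
  Filter.Eventually.mono (h.and hkk') fun _ ⟨⟨h1, _⟩, h2, h3⟩ =>
    ⟨h1.trans (by exact_mod_cast h2), h3⟩

/-- A smaller constant gives a weaker regime condition. [folklore] -/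
theorem InSqrtRegime.of_le {c c' : ℝ} {k : ℕ → ℕ} (h : InSqrtRegime c k) (hc : c' ≤ c) :
    InSqrtRegime c' k :=
  Filter.Eventually.mono h fun _ ⟨h1, h2⟩ =>
    ⟨(mul_le_mul_of_nonneg_right hc (Real.sqrt_nonneg _)).trans h1, h2⟩

end Literature.Probability.RandomGraphs.PlantedClique

end
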